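import Literature.MathematicalPhysics.QuantumFieldTheory.Balaban1983to89.B1Eq324BenfattoKernelSect5SlotMoments
import Literature.MathematicalPhysics.QuantumFieldTheory.Balaban1983to89.B1Eq324BenfattoSect5ChiToOneOnData
import Literature.MathematicalPhysics.QuantumFieldTheory.Balaban1983to89.B1Eq324BenfattoKernelAppendixCLemma2
import HarnessLib

/-!
# `Balaban1983to89.B1Eq324BenfattoKernelSect5ChiToOneOnData` — [BenfattoEtAl1978] §5 (5.29) pp. 157–158, FIRST TERM «the replacement of the
# χ's by 1», FOR A SHIFTED GAUSSIAN KERNEL FIELD `𝒩(0,K)∘(u + ·)⁻¹` ON PRINT'S BOX EVENT: `|𝓔^T(Z₁χ,…,Z_kχ) − 𝓔^T(Z₁,…,Z_k)| ≤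
# 2^k(Σ_π(|π|−1)!)·(min 1 (2|□|e^{−b²/4}))^{1/(2k)}·L^k` for print's tuple-class slots, from the DISPLAYED rows `K(y,y) ≤ c₀`,
# `|u| ≤ Kᵤ` on the region, and the two Lemma-2 rows on the box `K(x,x) ≤ ½`, `|u(x)| ≤ ½b(1+d(Δ_x,I))` — PROVED

statement-level skeleton of published theorems with citation tags; proofs where landed; nothing here is a claim about the
Yang–Mills mass gap

WHY THIS MODULE (cell `pub-ymgap`, seat `dag-n08-c` gen 31; node N08 [Balaban1985UV3]; the [BenfattoEtAl1978] source chain behind the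
(α)-row `h324`; ROW 6 of the seat's cluster-side port map `N08-PORT-MAP-CLUSTER-SIDE.md` §1).  `…B1Eq324BenfattoSect5ChiToOneOnData` closes
(5.29)'s first term on print's objects for the conditioned FREE field: the χ-removal knit of `…Sect5SlotMoments` §6 with «point 2)» and the
tail `P̄(χ ≠ 1) ≤ 2|□|e^{−b²/4}` of Appendix C Lemma 2, both SUPPLIED from the free field's data (`E z² ≤ ½`, `γ(1+2d/α²) ≤ ½`, boundary
data `|z̄_c| ≤ γb(1+d(Δ_c,I))`).  For the class road's part fields `N^K_{P,ξ} = (gaussianFieldOfKernel K_P).map (u_Γ(ξ) + ·)` the same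
statement is needed with those three free-field facts replaced by ROWS on a generic kernel `K` and centre `u`: R1 `K(y,y) ≤ c₀` (moments),
R3 `|u(y)| ≤ Kᵤ` on the region `I ⊇ J` carrying the slots, and the two Lemma-2 rows ON THE BOX — R1′ `K(x,x) ≤ ½` and R3′
`|u(x)| ≤ ½·b·(1 + d(Δ_x, I))` — under which `…KernelAppendixCLemma2.appC_lemma2_of_shift` (seat n08-c g21) gives the tail.  The knit
itself is row 1's `…KernelSect5SlotMoments.abs_ursellOf_poly_mul_sub_shift_le` / `tupleSum_shift_moments_of_subset` with n08-b's
measure-generic `…Sect5ChiToOne.abs_ursellOf_moment_mul_sub_le_of_moments`; the real-number packaging `measureReal_le_min_rpow_pow` of the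
concrete module is reused BY NAME.

DICTIONARY.  `μ_{K,u}` ↦ `(gaussianFieldOfKernel K).map fun ζ y => u y + ζ y` (VERBATIM); print's `χ_b^□` ↦ a measurable weight `0 ≤ χ ≤ 1`
equal to `1` on `{z | ∀ x ∈ □, |z_x| < b(1 + d(Δ_x, I))}`; rows as above.  The concrete module is the instance `K := condCov (freeCov d α β) Γ`,
`u := condMean (freeCov d α β) Γ z̄`, `c₀ := (freeCov d α β 0 0)⁺`, `Kᵤ := (1 + 2d/α²)γb` (rows R1′/R3′ from `condCov_self_le` + `hvar` and
from (C.8) `abs_condMean_freeCov_le'` + `γ(1+2d/α²) ≤ ½`).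

WHAT IS PROVED (theorems only; no definition, no named fact, no `sorry`; axioms standard).
* `measureReal_ne_one_le_of_eq_one_on_shift` — the tail `μ_{K,u}{χ ≠ 1} ≤ 2|□|e^{−b²/4}` from R1′/R3′ (Lemma 2 of App. C for the shifted
  kernel field, `appC_lemma2_of_shift`).
* ★★ `abs_ursellOf_tupleSum_mul_sub_shift_le_of_rows` — (5.29) FIRST TERM for print's tuple-class slots over `J ⊆ I` under `μ_{K,u}`:
  `≤ 2^k(Σ_π(|π|−1)!)·(min 1 (2|□|e^{−b²/4}))^{1/(2k)}·L^k`, `L = (1+Kᵤ)^D · M · momentConst D (2k) c₀`.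
* ★ `abs_ursellOf_poly_mul_sub_shift_le_of_rows` — the same for abstract polynomial slots with legs in `I`.

HONEST SCOPE / NOT HERE.  Rows DISPLAYED, not discharged (at the class's per-box instance: `…KernelOfPrecision` F3/F5, port map §2 R1/R3/R5);
one self-located row of an UNCOMMISSIONED port (plan g81 (II), START-LIST v11 §n08) — nothing chained; no generalised Basic Lemma is stated;
nothing of [Balaban1985UV3] is asserted; count-neutral for N08; nothing about d = 4, the continuum, OS axioms, a mass gap or the Clay problem.
-/

open Finset MeasureTheory
open scoped BigOperators NNReal Nat

namespace Literature.MathematicalPhysics.QuantumFieldTheory.Balaban1983to89.B1Eq324BenfattoKernelSect5ChiToOneOnData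

open _root_.MeasureTheory _root_.ProbabilityTheory
open Literature.Probability.LatticeModels (setPartitions ursellOf)
open Literature.MathematicalPhysics.QuantumFieldTheory
open Literature.MathematicalPhysics.QuantumFieldTheory.Balaban1983to89.B1Eq324GaussianMomentLeaf (poly momentConst one_le_momentConst)
open Literature.MathematicalPhysics.QuantumFieldTheory.Balaban1983to89.B1Eq324BenfattoLemma
open Literature.MathematicalPhysics.QuantumFieldTheory.Balaban1983to89.B1Eq324BenfattoConnLength (connLength_nonneg)
open Literature.MathematicalPhysics.QuantumFieldTheory.Balaban1983to89.B1Eq324BenfattoKernelAppendixCLemma2 (appC_lemma2_of_shift)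
open Literature.MathematicalPhysics.QuantumFieldTheory.Balaban1983to89.B1Eq324BenfattoSect5Cumulant (measurableSet_boxSmallField)
open Literature.MathematicalPhysics.QuantumFieldTheory.Balaban1983to89.B1Eq324BenfattoSect5Eq511 (term)
open Literature.MathematicalPhysics.QuantumFieldTheory.Balaban1983to89.B1Eq324BenfattoSect5ChiToOne
  (abs_ursellOf_moment_mul_sub_le_of_moments)
open Literature.MathematicalPhysics.QuantumFieldTheory.Balaban1983to89.B1Eq324BenfattoSect5ChiToOneOnData (measureReal_le_min_rpow_pow)
open Literature.MathematicalPhysics.QuantumFieldTheory.Balaban1983to89.B1Eq324BenfattoKernelSect5SlotMoments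
  (tupleSum_shift_moments_of_subset abs_ursellOf_poly_mul_sub_shift_le)

variable {d : ℕ} {K : B1Eq324BenfattoLemma.Site d → B1Eq324BenfattoLemma.Site d → ℝ}

/-- **THE TAIL OF `χ_b^□` UNDER A SHIFTED KERNEL FIELD (Appendix C Lemma 2 as `μ_{K,u}(χ ≠ 1)`)**: for a weight `χ` equal to `1` on the box
small-field event `E = {z | ∀ x ∈ □, |z_x| < b(1 + d(Δ_x, I))}`, and the Lemma-2 rows on the box `K(x,x) ≤ ½`, `|u(x)| ≤ ½·b·(1 + d(Δ_x, I))`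
(`b > 0`): `μ_{K,u}{χ ≠ 1} ≤ μ_{K,u}(Eᶜ) ≤ 2|□|e^{−b²/4}` (`…KernelAppendixCLemma2.appC_lemma2_of_shift`).  The concrete
`…Sect5ChiToOneOnData.measureReal_ne_one_le_of_eq_one_on` is the instance `K := condCov (freeCov …) Γ`, `u := condMean … z̄`.
[cite: BenfattoEtAl1978, Appendix C Lemma 2 p.165 and (5.19) p.156] -/
theorem measureReal_ne_one_le_of_eq_one_on_shift (hK : IsPosSemidefKernel K) (u : B1Eq324BenfattoLemma.Site d → ℝ) {b : ℝ}
    (hb : 0 < b) (I box : Finset (B1Eq324BenfattoLemma.Site d)) (hvar : ∀ x ∈ box, K x x ≤ 1 / 2)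
    (hm : ∀ x ∈ box, |u x| ≤ 1 / 2 * b * (1 + distToRegion I x))
    {χ : (B1Eq324BenfattoLemma.Site d → ℝ) → ℝ}
    (hχE : ∀ z : B1Eq324BenfattoLemma.Site d → ℝ, (∀ x ∈ box, |z x| < b * (1 + distToRegion I x)) → χ z = 1) :
    ((gaussianFieldOfKernel K).map
        fun (ζ : B1Eq324BenfattoLemma.Site d → ℝ) (y : B1Eq324BenfattoLemma.Site d) => u y + ζ y).real {z | χ z ≠ 1} ≤
      2 * (box.card : ℝ) * Real.exp (-(b ^ 2 / 4)) := by
  haveI := isProbabilityMeasure_gaussianFieldOfKernel hK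
  have hTm : Measurable (fun (ζ : B1Eq324BenfattoLemma.Site d → ℝ) (y : B1Eq324BenfattoLemma.Site d) => u y + ζ y) :=
    measurable_pi_lambda _ fun y => measurable_const.add (measurable_pi_apply y)
  haveI : IsProbabilityMeasure ((gaussianFieldOfKernel K).map
      fun (ζ : B1Eq324BenfattoLemma.Site d → ℝ) (y : B1Eq324BenfattoLemma.Site d) => u y + ζ y) :=
    Measure.isProbabilityMeasure_map hTm.aemeasurable
  set μ := (gaussianFieldOfKernel K).map
    fun (ζ : B1Eq324BenfattoLemma.Site d → ℝ) (y : B1Eq324BenfattoLemma.Site d) => u y + ζ y with hμ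
  set E : Set (B1Eq324BenfattoLemma.Site d → ℝ) := {z | ∀ x ∈ box, |z x| < b * (1 + distToRegion I x)} with hE
  have hEm : MeasurableSet E := measurableSet_boxSmallField b I box
  have hsub : {z : B1Eq324BenfattoLemma.Site d → ℝ | χ z ≠ 1} ⊆ Eᶜ := fun z hz1 hzE => hz1 (hχE z hzE)
  have hL2 := appC_lemma2_of_shift hK u hb I box hvar hm
  calc μ.real {z | χ z ≠ 1} ≤ μ.real Eᶜ := measureReal_mono hsub (measure_ne_top _ _)
    _ = 1 - μ.real E := probReal_compl_eq_one_sub hEm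
    _ ≤ 2 * (box.card : ℝ) * Real.exp (-(b ^ 2 / 4)) := by rw [hμ]; linarith

variable {s D : ℕ} {ϰ : ℝ} {a : Coef d} {Jr : Finset (B1Eq324BenfattoLemma.Site d)} {σ : Type*} [Fintype σ] [DecidableEq σ]
  [Nonempty σ]

/-- **(5.29), FIRST TERM «χ → 1», FOR PRINT'S SLOTS UNDER A SHIFTED KERNEL FIELD — from displayed rows only**: for `k = |σ|` tuple-class
polynomial slots `Z_j(z) = Σ_{p∈Icc 1 s} Σ_{Δ∈T_j p} Σ_{n∈admissible p D} A^n_Δ e^{−(ϰ/2)d(Δ)} Π z_{Δᵢ}^{nᵢ}` over `J ⊆ I` (decay-weighted coefficient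
masses `𝓜_j ≤ M`) under `μ_{K,u}` with rows R0 `hK`, R1 `K(y,y) ≤ c₀`, R3 `|u(y)| ≤ Kᵤ` on `I` (`Kᵤ ≥ 0`), the Lemma-2 rows on the box
`K(x,x) ≤ ½`, `|u(x)| ≤ ½·b·(1 + d(Δ_x, I))` (`b > 0`), and a measurable weight `0 ≤ χ ≤ 1` equal to `1` on the box event:
`|𝓔^T(Z₁χ,…,Z_kχ) − 𝓔^T(Z₁,…,Z_k)| ≤ 2^k·(Σ_{π∈𝒫(k)}(|π|−1)!)·(min 1 (2|□|e^{−b²/4}))^{1/(2k)}·L^k`, `L = (1+Kᵤ)^D · M · momentConst D (2k) c₀`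
— n08-b's ChiToOne theorem with «point 2)» from row 1 (`…KernelSect5SlotMoments.tupleSum_shift_moments_of_subset`) and the tail from
`measureReal_ne_one_le_of_eq_one_on_shift`.  The concrete `…Sect5ChiToOneOnData.abs_ursellOf_tupleSum_mul_sub_le_of_smallFieldData` is the
instance `K := condCov (freeCov …) Γ`, `u := condMean … z̄`, `Kᵤ := (1+2d/α²)γb`.
[cite: BenfattoEtAl1978, (5.29) p.157–158, Appendix D p.165, Appendix C Lemma 2 p.165] -/
theorem abs_ursellOf_tupleSum_mul_sub_shift_le_of_rows (hK : IsPosSemidefKernel K) (u : B1Eq324BenfattoLemma.Site d → ℝ)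
    {c₀ : ℝ≥0} (hdiag : ∀ y, K y y ≤ c₀) {b : ℝ} (hb : 0 < b)
    (I box : Finset (B1Eq324BenfattoLemma.Site d)) {Ku : ℝ} (hKu : 0 ≤ Ku) (hu : ∀ y ∈ I, |u y| ≤ Ku)
    (hvar : ∀ x ∈ box, K x x ≤ 1 / 2) (hm : ∀ x ∈ box, |u x| ≤ 1 / 2 * b * (1 + distToRegion I x)) (hJI : Jr ⊆ I)
    (T : σ → (p : ℕ) → Finset (Fin p → Jr)) {M : ℝ}
    (hM : ∀ j, ∑ p ∈ Finset.Icc 1 s, ∑ Δ ∈ T j p, ∑ n ∈ admissible p D,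
        |a p (fun i => (Δ i : B1Eq324BenfattoLemma.Site d)) n| *
          Real.exp (-(ϰ / 2) * connLength fun i => (Δ i : B1Eq324BenfattoLemma.Site d)) ≤ M)
    {χ : (B1Eq324BenfattoLemma.Site d → ℝ) → ℝ} (hχm : Measurable χ) (hχ0 : ∀ z, 0 ≤ χ z) (hχ1 : ∀ z, χ z ≤ 1)
    (hχE : ∀ z : B1Eq324BenfattoLemma.Site d → ℝ, (∀ x ∈ box, |z x| < b * (1 + distToRegion I x)) → χ z = 1) :
    |ursellOf (fun P : Finset σ => ∫ z, ∏ j ∈ P,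
          (∑ p ∈ Finset.Icc 1 s, ∑ Δ ∈ T j p, ∑ n ∈ admissible p D, term ϰ a z p Δ n) * χ z
            ∂((gaussianFieldOfKernel K).map
              fun (ζ : B1Eq324BenfattoLemma.Site d → ℝ) (y : B1Eq324BenfattoLemma.Site d) => u y + ζ y))
        Finset.univ -
      ursellOf (fun P : Finset σ => ∫ z, ∏ j ∈ P,
          (∑ p ∈ Finset.Icc 1 s, ∑ Δ ∈ T j p, ∑ n ∈ admissible p D, term ϰ a z p Δ n)
            ∂((gaussianFieldOfKernel K).map
              fun (ζ : B1Eq324BenfattoLemma.Site d → ℝ) (y : B1Eq324BenfattoLemma.Site d) => u y + ζ y))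
        Finset.univ| ≤
      2 ^ Fintype.card σ * ((∑ π ∈ setPartitions (Finset.univ : Finset σ), ((π.card - 1)! : ℝ)) *
        ((min 1 (2 * (box.card : ℝ) * Real.exp (-(b ^ 2 / 4)))) ^ ((2 * Fintype.card σ : ℕ) : ℝ)⁻¹ *
          ((1 + Ku) ^ D * M * momentConst D (2 * Fintype.card σ) c₀) ^ Fintype.card σ)) := by
  haveI := isProbabilityMeasure_gaussianFieldOfKernel hK
  have hTm : Measurable (fun (ζ : B1Eq324BenfattoLemma.Site d → ℝ) (y : B1Eq324BenfattoLemma.Site d) => u y + ζ y) :=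
    measurable_pi_lambda _ fun y => measurable_const.add (measurable_pi_apply y)
  haveI : IsProbabilityMeasure ((gaussianFieldOfKernel K).map
      fun (ζ : B1Eq324BenfattoLemma.Site d → ℝ) (y : B1Eq324BenfattoLemma.Site d) => u y + ζ y) :=
    Measure.isProbabilityMeasure_map hTm.aemeasurable
  set Kf := (1 + Ku) ^ D with hKf
  have hKf0 : 0 ≤ Kf := pow_nonneg (by linarith) _
  have hmc : 1 ≤ momentConst D (2 * Fintype.card σ) c₀ := one_le_momentConst _ _ _
  have hM0 : 0 ≤ M := (Finset.sum_nonneg fun p _ => Finset.sum_nonneg fun Δ _ => Finset.sum_nonneg fun n _ =>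
    mul_nonneg (abs_nonneg _) (Real.exp_pos _).le).trans (hM (Classical.arbitrary σ))
  have hk : (2 * Fintype.card σ : ℕ) ≠ 0 := by
    have := Fintype.card_pos (α := σ)
    omega
  have hpk := fun j => tupleSum_shift_moments_of_subset (s := s) (D := D) (ϰ := ϰ) (a := a) hK u hdiag I hKu hu hJI (T j)
    (2 * Fintype.card σ)
  have ht1 : ((gaussianFieldOfKernel K).map
      fun (ζ : B1Eq324BenfattoLemma.Site d → ℝ) (y : B1Eq324BenfattoLemma.Site d) => u y + ζ y).real {z | χ z ≠ 1} ≤ 1 :=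
    measureReal_le_one
  obtain ⟨htail, hη0, hη1⟩ := measureReal_le_min_rpow_pow measureReal_nonneg ht1
    (measureReal_ne_one_le_of_eq_one_on_shift hK u hb I box hvar hm hχE) hk
  refine abs_ursellOf_moment_mul_sub_le_of_moments
    (μ := (gaussianFieldOfKernel K).map
      fun (ζ : B1Eq324BenfattoLemma.Site d → ℝ) (y : B1Eq324BenfattoLemma.Site d) => u y + ζ y)
    (Z := fun j z => ∑ p ∈ Finset.Icc 1 s, ∑ Δ ∈ T j p, ∑ n ∈ admissible p D, term ϰ a z p Δ n)
    (fun j => (hpk j).1) (fun j p _ => (hpk j).2.1 p) (fun j p hp => ((hpk j).2.2 p hp).trans ?_) hχm hχ0 hχ1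
    (mul_nonneg (mul_nonneg hKf0 hM0) (zero_le_one.trans hmc)) hη0 hη1 htail
  exact pow_le_pow_left₀ (mul_nonneg (mul_nonneg hKf0 (Finset.sum_nonneg fun p _ => Finset.sum_nonneg fun Δ _ =>
    Finset.sum_nonneg fun n _ => mul_nonneg (abs_nonneg _) (Real.exp_pos _).le)) (zero_le_one.trans hmc))
    (mul_le_mul_of_nonneg_right (mul_le_mul_of_nonneg_left (hM j) hKf0) (zero_le_one.trans hmc)) p

/-- **The same for abstract polynomial slots** `Z_j = Σ_{i∈I_j} a_{ji} Π_{l∈J_{ji}} z(x_{jil})` with all legs in the region `I` (degrees `≤ q`,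
coefficient masses `≤ M`) under `μ_{K,u}` with the rows of `abs_ursellOf_tupleSum_mul_sub_shift_le_of_rows`:
`|𝓔^T(Z₁χ,…,Z_kχ) − 𝓔^T(Z₁,…,Z_k)| ≤ 2^k(Σ_π(|π|−1)!)·(min 1 (2|□|e^{−b²/4}))^{1/(2k)}·L^k`, `L = (1+Kᵤ)^q · M · momentConst q (2k) c₀`
(row 1's `…KernelSect5SlotMoments.abs_ursellOf_poly_mul_sub_shift_le` + the tail).  The concrete
`…Sect5ChiToOneOnData.abs_ursellOf_poly_mul_sub_le_of_smallFieldData` is the instance `K := condCov (freeCov …) Γ`, `u := condMean … z̄`.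
[cite: BenfattoEtAl1978, (5.29) p.157–158, Appendix D p.165, Appendix C Lemma 2 p.165] -/
theorem abs_ursellOf_poly_mul_sub_shift_le_of_rows {ι κ : Type*} [DecidableEq κ] (hK : IsPosSemidefKernel K)
    (u : B1Eq324BenfattoLemma.Site d → ℝ) {c₀ : ℝ≥0} (hdiag : ∀ y, K y y ≤ c₀) {b : ℝ} (hb : 0 < b)
    (I box : Finset (B1Eq324BenfattoLemma.Site d)) {Ku : ℝ} (hKu : 0 ≤ Ku) (hu : ∀ y ∈ I, |u y| ≤ Ku)
    (hvar : ∀ x ∈ box, K x x ≤ 1 / 2) (hm : ∀ x ∈ box, |u x| ≤ 1 / 2 * b * (1 + distToRegion I x))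
    (Is : σ → Finset ι) (J : σ → ι → Finset κ) (av : σ → ι → ℝ) (x : σ → ι → κ → B1Eq324BenfattoLemma.Site d)
    (hxI : ∀ j, ∀ i ∈ Is j, ∀ l ∈ J j i, x j i l ∈ I) {q : ℕ} (hq : ∀ j, ∀ i ∈ Is j, (J j i).card ≤ q) {M : ℝ}
    (hM : ∀ j, ∑ i ∈ Is j, |av j i| ≤ M)
    {χ : (B1Eq324BenfattoLemma.Site d → ℝ) → ℝ} (hχm : Measurable χ) (hχ0 : ∀ z, 0 ≤ χ z) (hχ1 : ∀ z, χ z ≤ 1)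
    (hχE : ∀ z : B1Eq324BenfattoLemma.Site d → ℝ, (∀ x ∈ box, |z x| < b * (1 + distToRegion I x)) → χ z = 1) :
    |ursellOf (fun P : Finset σ => ∫ z, ∏ j ∈ P,
          poly (Is j) (J j) (av j) (fun i l (z : B1Eq324BenfattoLemma.Site d → ℝ) => z (x j i l)) z * χ z
            ∂((gaussianFieldOfKernel K).map
              fun (ζ : B1Eq324BenfattoLemma.Site d → ℝ) (y : B1Eq324BenfattoLemma.Site d) => u y + ζ y))
        Finset.univ -
      ursellOf (fun P : Finset σ => ∫ z, ∏ j ∈ P,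
          poly (Is j) (J j) (av j) (fun i l (z : B1Eq324BenfattoLemma.Site d → ℝ) => z (x j i l)) z
            ∂((gaussianFieldOfKernel K).map
              fun (ζ : B1Eq324BenfattoLemma.Site d → ℝ) (y : B1Eq324BenfattoLemma.Site d) => u y + ζ y))
        Finset.univ| ≤
      2 ^ Fintype.card σ * ((∑ π ∈ setPartitions (Finset.univ : Finset σ), ((π.card - 1)! : ℝ)) *
        ((min 1 (2 * (box.card : ℝ) * Real.exp (-(b ^ 2 / 4)))) ^ ((2 * Fintype.card σ : ℕ) : ℝ)⁻¹ *
          ((1 + Ku) ^ q * M * momentConst q (2 * Fintype.card σ) c₀) ^ Fintype.card σ)) := by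
  haveI := isProbabilityMeasure_gaussianFieldOfKernel hK
  have hTm : Measurable (fun (ζ : B1Eq324BenfattoLemma.Site d → ℝ) (y : B1Eq324BenfattoLemma.Site d) => u y + ζ y) :=
    measurable_pi_lambda _ fun y => measurable_const.add (measurable_pi_apply y)
  haveI : IsProbabilityMeasure ((gaussianFieldOfKernel K).map
      fun (ζ : B1Eq324BenfattoLemma.Site d → ℝ) (y : B1Eq324BenfattoLemma.Site d) => u y + ζ y) :=
    Measure.isProbabilityMeasure_map hTm.aemeasurable
  have hk : (2 * Fintype.card σ : ℕ) ≠ 0 := by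
    have := Fintype.card_pos (α := σ)
    omega
  have ht1 : ((gaussianFieldOfKernel K).map
      fun (ζ : B1Eq324BenfattoLemma.Site d → ℝ) (y : B1Eq324BenfattoLemma.Site d) => u y + ζ y).real {z | χ z ≠ 1} ≤ 1 :=
    measureReal_le_one
  obtain ⟨htail, hη0, hη1⟩ := measureReal_le_min_rpow_pow measureReal_nonneg ht1
    (measureReal_ne_one_le_of_eq_one_on_shift hK u hb I box hvar hm hχE) hk
  exact abs_ursellOf_poly_mul_sub_shift_le hK u hdiag Is J av x hKu
    (fun j i hi l hl => hu _ (hxI j i hi l hl)) hq hM hχm hχ0 hχ1 hη0 hη1 htail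

end Literature.MathematicalPhysics.QuantumFieldTheory.Balaban1983to89.B1Eq324BenfattoKernelSect5ChiToOneOnData
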